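import Literature.Geometry.Riemannian.MetricFlowFDistanceTriangle
import Literature.Geometry.Riemannian.MetricFlowFConvergenceTimewise
import Literature.Geometry.Riemannian.MetricFlowFConvergenceMeasures
import HarnessLib

/-!
# Comparing two couplings, and flexibility in the choice of the couplings of the `𝔽`-distance
# (Bamler 2023, §5.3, Lemma 5.18 and Lemma 5.19)

R. Bamler, *Compactness theory of the space of super Ricci flows*, Invent. Math. 233 (2023), §5.3
(arXiv v1 Lemmas 118, 119). Lemma 5.18 ("compare two different couplings between probability
measures in two metric flows"): "Let `ℭ = ((Z_t, d^Z_t)_{t ∈ I''}, (φ^i_t)_{t ∈ I''^{,i}, i = 1,2})`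
be a correspondence between two metric flows `𝒳¹, 𝒳²` and consider times
`s, t ∈ I''^{,1} ∩ I''^{,2}`, `s ≤ t`. Let `μ₁, μ'₁ ∈ 𝒫(𝒳¹_t)`, `μ₂ ∈ 𝒫(𝒳²_t)` and consider
couplings `q, q'` between `μ₁, μ₂` and `μ'₁, μ₂`, respectively. Then
`∫_{𝒳¹_t × 𝒳²_t} d_{W₁}^{Z_s}((φ¹_s)_* ν¹_{x¹;s}, (φ²_s)_* ν²_{x²;s}) dq'(x¹, x²)
  ≤ ∫_{𝒳¹_t × 𝒳²_t} (d^Z_t(φ¹_t(x¹), φ²_t(x²))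
      + d_{W₁}^{Z_s}((φ¹_s)_* ν¹_{x¹;s}, (φ²_s)_* ν²_{x²;s})) dq(x¹, x²)
    + ∫_{𝒳¹_t × 𝒳²_t} d^Z_t(φ¹_t(x¹), φ²_t(x²)) dq'(x¹, x²)`."
Proof (source): glue `q, q'` along the common marginal `μ₂` to `q̄ ∈ 𝒫(𝒳¹_t × 𝒳¹_t × 𝒳²_t)`, and
integrate the pointwise estimate
`d_{W₁}(ν¹_{y¹}, ν²_{x²}) ≤ d_{W₁}(ν¹_{y¹}, ν¹_{x¹}) + d_{W₁}(ν¹_{x¹}, ν²_{x²})`,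
`d_{W₁}^{Z_s}((φ¹_s)_* ν¹_{y¹;s}, (φ¹_s)_* ν¹_{x¹;s}) ≤ d_t(y¹, x¹)` (§3.2, Proposition (c)) and
`d_t(y¹, x¹) ≤ d^Z_t(φ¹_t(y¹), φ²_t(x²)) + d^Z_t(φ²_t(x²), φ¹_t(x¹))`.

Lemma 5.19 ("we are quite flexible in the choice of the couplings"): "consider a correspondence `ℭ`
between `𝒳¹, 𝒳²` over `I''` that is fully defined over two times `{s, t}`, `s ≤ t`. Then for any
coupling `q'` between `μ¹_t, μ²_t` we have
`∫_{𝒳¹_t × 𝒳²_t} d_{W₁}^{Z_s}((φ¹_s)_* ν¹_{x¹;s}, (φ²_s)_* ν²_{x²;s}) dq'(x¹, x²)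
  ≤ ∫_{𝒳¹_t × 𝒳²_t} d^Z_t(φ¹_t(x¹), φ²_t(x²)) dq'(x¹, x²)
    + 2 d_𝔽^{ℭ,{s,t}}((𝒳¹, (μ¹_t)), (𝒳², (μ²_t)))`."
("a direct consequence of Lemma 5.18": take `μ₁ = μ'₁ = μ¹_t` and `q = q_t` an admissible coupling
of Definition (`𝔽`-distance within correspondence); its condition (2) at `(s, t)` and at `(t, t)`,
where the integrand is `d_{W₁}(δ_{φ¹_t x¹}, δ_{φ²_t x²}) = d^Z_t(φ¹_t x¹, φ²_t x²)`, bounds the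
`q`-integral by `r + r`.)

This file proves both, in the vocabulary of `MetricFlowFDistance.lean` (the integrand
`MetricFlowPair.kernelDistWithin`, admissible radii `FDistAdmissible`, `fDistWithin = d_𝔽^{ℭ,J}`,
lower Lebesgue integrals valued in `[0, ∞]`):

* `kernelDistWithin_le_edist_add` — the pointwise estimate of the proof of Lemma 5.18;
* `lintegral_kernelDistWithin_le_of_isCoupling` — **Lemma 5.18**;
* `lintegral_kernelDistWithin_le_add_two_mul_ofReal` — Lemma 5.19 for an admissible radius `r`;
* `lintegral_kernelDistWithin_le_add_two_mul_fDistWithin` — **Lemma 5.19**, stated for times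
  `s ≤ t` of any `J` over which `ℭ` is fully defined, with `d_𝔽^{ℭ,J}` on the right (for
  `J = {s, t}` this is the printed statement; `d_𝔽^{ℭ,{s,t}} ≤ d_𝔽^{ℭ,J}` when `{s, t} ⊆ J`).

As in `MetricFlowFDistanceTriangle.lean`, the flows are assumed `H`-concentrated (the standing
assumption of Bamler's theory): this makes the integrand Borel measurable
(`measurable_kernelDistWithin`), which the integration of the pointwise estimate against the glued
coupling requires (lower integrals are only super-additive), and gives §3.2 Proposition (c) in the
form `IsHConcentrated.wassersteinW1_condKernel_le_edist`.

## References

* R. H. Bamler, *Compactness theory of the space of super Ricci flows*, Invent. Math. 233 (2023),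
  1121–1277 (arXiv:2008.09298), §5.3, Lemma 5.18, Lemma 5.19 (arXiv v1 Lemmas 118, 119); §5.1,
  Definition (`𝔽`-distance within correspondence); §3.2, Proposition (c). [Bamler2023]
* C. Villani, *Topics in Optimal Transportation*, GSM 58 (AMS 2003), Lemma 7.6 (gluing lemma).
  [Villani2003]
-/

noncomputable section

open Set MeasureTheory Filter TopologicalSpace Function
open scoped Topology ENNReal NNReal

namespace Literature.Geometry.Riemannian

universe u

namespace MetricFlowPair

open MetricFlow

variable {I₁ I₂ : Set ℝ} {P₁ : MetricFlowPair.{u} I₁} {P₂ : MetricFlowPair.{u} I₂} {I'' : Set ℝ}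

/-! ### Lemma 5.18: comparing two couplings -/

/-- **The pointwise estimate of the proof of Lemma 5.18** (Bamler 2023, §5.3): for `s ≤ t` in
`I''^{,1} ∩ I''^{,2}`, `x¹, y¹ ∈ 𝒳¹_t` and `x² ∈ 𝒳²_t`,
`d_{W₁}^{Z_s}((φ¹_s)_* ν¹_{y¹;s}, (φ²_s)_* ν²_{x²;s}) ≤ d^Z_t(φ¹_t x¹, φ²_t x²) +
d_{W₁}^{Z_s}((φ¹_s)_* ν¹_{x¹;s}, (φ²_s)_* ν²_{x²;s}) + d^Z_t(φ¹_t y¹, φ²_t x²)`: the triangle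
inequality for `d_{W₁}` between push-forwards under the isometric embeddings `φ^i_s`
(`wassersteinW1_map_triangle`), `d_{W₁}^{Z_s}((φ¹_s)_* ν¹_{y¹;s}, (φ¹_s)_* ν¹_{x¹;s}) ≤
d_{W₁}(ν¹_{y¹;s}, ν¹_{x¹;s}) ≤ d_t(y¹, x¹)` (§3.2, Proposition (c),
`IsHConcentrated.wassersteinW1_condKernel_le_edist`) and
`d_t(y¹, x¹) = d^Z_t(φ¹_t y¹, φ¹_t x¹) ≤ d^Z_t(φ¹_t y¹, φ²_t x²) + d^Z_t(φ²_t x², φ¹_t x¹)`.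
[cite: Bamler2023, §5.3, Lemma 5.18 (arXiv v1 Lemma 118), proof] -/
theorem kernelDistWithin_le_edist_add {H₁ : ℝ} (hH₁ : P₁.flow.IsHConcentrated H₁)
    (ℭ : Correspondence₂ P₁.flow P₂.flow I'') {s t : ℝ}
    (hs₁ : s ∈ ℭ.dom₁) (hs₂ : s ∈ ℭ.dom₂) (ht₁ : t ∈ ℭ.dom₁) (ht₂ : t ∈ ℭ.dom₂) (hst : s ≤ t)
    (x₁ y₁ : P₁.flow.Slice ⟨t, (ℭ.dom₁_subset ht₁).1⟩)
    (x₂ : P₂.flow.Slice ⟨t, (ℭ.dom₂_subset ht₂).1⟩) :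
    kernelDistWithin P₁ P₂ ℭ hs₁ hs₂ ht₁ ht₂ (y₁, x₂) ≤
      edist (ℭ.φ₁ t ht₁ x₁) (ℭ.φ₂ t ht₂ x₂) + kernelDistWithin P₁ P₂ ℭ hs₁ hs₂ ht₁ ht₂ (x₁, x₂) +
        edist (ℭ.φ₁ t ht₁ y₁) (ℭ.φ₂ t ht₂ x₂) := by
  haveI := P₁.flow.isProbabilityMeasure_condKernel (s := ⟨s, (ℭ.dom₁_subset hs₁).1⟩) x₁ hst
  haveI := P₁.flow.isProbabilityMeasure_condKernel (s := ⟨s, (ℭ.dom₁_subset hs₁).1⟩) y₁ hst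
  haveI := P₂.flow.isProbabilityMeasure_condKernel (s := ⟨s, (ℭ.dom₂_subset hs₂).1⟩) x₂ hst
  have hφ₁ := ℭ.isometry₁ s hs₁
  have hφ₂ := ℭ.isometry₂ s hs₂
  have hφ₁m : Measurable (ℭ.φ₁ s hs₁) := hφ₁.continuous.measurable
  -- the `W₁`-triangle inequality in `Z_s` through `(φ¹_s)_* ν¹_{x¹;s}`
  have h1 := wassersteinW1_map_triangle hφ₁ hφ₁ hφ₂
    (P₁.flow.condKernel y₁ ⟨s, (ℭ.dom₁_subset hs₁).1⟩)
    (P₁.flow.condKernel x₁ ⟨s, (ℭ.dom₁_subset hs₁).1⟩)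
    (P₂.flow.condKernel x₂ ⟨s, (ℭ.dom₂_subset hs₂).1⟩)
  -- the first term is at most `d_t(y¹, x¹)` (§3.2, Proposition (c))
  have e1 : wassersteinW1 ((P₁.flow.condKernel y₁ ⟨s, (ℭ.dom₁_subset hs₁).1⟩).map (ℭ.φ₁ s hs₁))
      ((P₁.flow.condKernel x₁ ⟨s, (ℭ.dom₁_subset hs₁).1⟩).map (ℭ.φ₁ s hs₁)) ≤ edist y₁ x₁ :=
    (wassersteinW1_map_le_of_edist_le hφ₁m (fun a b ↦ (hφ₁.edist_eq a b).le) _ _).trans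
      (hH₁.wassersteinW1_condKernel_le_edist hst y₁ x₁)
  -- `d_t(y¹, x¹) = d^Z_t(φ¹_t y¹, φ¹_t x¹) ≤ d^Z_t(φ¹_t y¹, φ²_t x²) + d^Z_t(φ²_t x², φ¹_t x¹)`
  have e2 : edist y₁ x₁ ≤
      edist (ℭ.φ₁ t ht₁ y₁) (ℭ.φ₂ t ht₂ x₂) + edist (ℭ.φ₁ t ht₁ x₁) (ℭ.φ₂ t ht₂ x₂) := by
    rw [← (ℭ.isometry₁ t ht₁).edist_eq y₁ x₁, edist_comm (ℭ.φ₁ t ht₁ x₁)]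
    exact edist_triangle _ _ _
  calc kernelDistWithin P₁ P₂ ℭ hs₁ hs₂ ht₁ ht₂ (y₁, x₂)
      ≤ _ := h1
    _ ≤ edist (ℭ.φ₁ t ht₁ y₁) (ℭ.φ₂ t ht₂ x₂) + edist (ℭ.φ₁ t ht₁ x₁) (ℭ.φ₂ t ht₂ x₂) +
          kernelDistWithin P₁ P₂ ℭ hs₁ hs₂ ht₁ ht₂ (x₁, x₂) := add_le_add (e1.trans e2) le_rfl
    _ = edist (ℭ.φ₁ t ht₁ x₁) (ℭ.φ₂ t ht₂ x₂) + kernelDistWithin P₁ P₂ ℭ hs₁ hs₂ ht₁ ht₂ (x₁, x₂) +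
          edist (ℭ.φ₁ t ht₁ y₁) (ℭ.φ₂ t ht₂ x₂) := by ring

/-- **Bamler 2023, Lemma 5.18 (arXiv v1 Lemma 118): comparing two couplings.** For a
correspondence `ℭ` between `H`-concentrated flows `𝒳¹, 𝒳²`, times `s ≤ t` in `I''^{,1} ∩ I''^{,2}`,
probability measures `μ₁, μ'₁` on `𝒳¹_t`, `μ₂` on `𝒳²_t` and couplings `q` of `μ₁, μ₂` and `q'` of
`μ'₁, μ₂`:
`∫ d_{W₁}^{Z_s}((φ¹_s)_* ν¹_{x¹;s}, (φ²_s)_* ν²_{x²;s}) dq' ≤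
∫ (d^Z_t(φ¹_t x¹, φ²_t x²) + d_{W₁}^{Z_s}((φ¹_s)_* ν¹_{x¹;s}, (φ²_s)_* ν²_{x²;s})) dq +
∫ d^Z_t(φ¹_t x¹, φ²_t x²) dq'`. As printed: glue `q` and `q'` along the common marginal `μ₂`
(`IsCoupling.exists_glue` on the Polish slices, applied to `q` and the swapped `q'`) to `q̄` on
`𝒳²_t × (𝒳¹_t × 𝒳¹_t)` and integrate the pointwise estimate `kernelDistWithin_le_edist_add` against
`q̄` (`lintegral_map`, `lintegral_add_left`; the integrand is Borel by
`measurable_kernelDistWithin`). [cite: Bamler2023, §5.3, Lemma 5.18 (arXiv v1 Lemma 118)] -/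
theorem lintegral_kernelDistWithin_le_of_isCoupling {H₁ H₂ : ℝ}
    (hH₁ : P₁.flow.IsHConcentrated H₁) (hH₂ : P₂.flow.IsHConcentrated H₂)
    (ℭ : Correspondence₂ P₁.flow P₂.flow I'') {s t : ℝ}
    (hs₁ : s ∈ ℭ.dom₁) (hs₂ : s ∈ ℭ.dom₂) (ht₁ : t ∈ ℭ.dom₁) (ht₂ : t ∈ ℭ.dom₂) (hst : s ≤ t)
    {μ₁ μ₁' : Measure (P₁.flow.Slice ⟨t, (ℭ.dom₁_subset ht₁).1⟩)}
    {μ₂ : Measure (P₂.flow.Slice ⟨t, (ℭ.dom₂_subset ht₂).1⟩)}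
    [IsProbabilityMeasure μ₁] [IsProbabilityMeasure μ₁'] [IsProbabilityMeasure μ₂]
    {q q' : Measure (P₁.flow.Slice ⟨t, (ℭ.dom₁_subset ht₁).1⟩ ×
      P₂.flow.Slice ⟨t, (ℭ.dom₂_subset ht₂).1⟩)}
    (hq : IsCoupling μ₁ μ₂ q) (hq' : IsCoupling μ₁' μ₂ q') :
    ∫⁻ p, kernelDistWithin P₁ P₂ ℭ hs₁ hs₂ ht₁ ht₂ p ∂q' ≤
      ∫⁻ p, (edist (ℭ.φ₁ t ht₁ p.1) (ℭ.φ₂ t ht₂ p.2) +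
          kernelDistWithin P₁ P₂ ℭ hs₁ hs₂ ht₁ ht₂ p) ∂q +
        ∫⁻ p, edist (ℭ.φ₁ t ht₁ p.1) (ℭ.φ₂ t ht₂ p.2) ∂q' := by
  -- notation: the two slices, the integrand `K` and the distance term `D`
  set X₁ := P₁.flow.Slice ⟨t, (ℭ.dom₁_subset ht₁).1⟩
  set X₂ := P₂.flow.Slice ⟨t, (ℭ.dom₂_subset ht₂).1⟩
  set K : X₁ × X₂ → ℝ≥0∞ := fun p ↦ kernelDistWithin P₁ P₂ ℭ hs₁ hs₂ ht₁ ht₂ p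
  set D : X₁ × X₂ → ℝ≥0∞ := fun p ↦ edist (ℭ.φ₁ t ht₁ p.1) (ℭ.φ₂ t ht₂ p.2)
  have hK : Measurable K := measurable_kernelDistWithin hH₁ hH₂ ℭ hs₁ hs₂ ht₁ ht₂ hst
  have hD : Measurable D :=
    (((ℭ.isometry₁ t ht₁).continuous.comp continuous_fst).edist
      ((ℭ.isometry₂ t ht₂).continuous.comp continuous_snd)).measurable
  -- glue `q` and the swapped `q'` along the common marginal `μ₂`
  haveI := hq'.1
  have hc : IsCoupling μ₂ μ₁' (q'.map Prod.swap) :=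
    ⟨Measure.isProbabilityMeasure_map measurable_swap.aemeasurable,
      by rw [Measure.fst_map_swap]; exact hq'.2.2, by rw [Measure.snd_map_swap]; exact hq'.2.1⟩
  obtain ⟨γ, hγP, hγq, hγq'⟩ := hq.exists_glue hc
  have hπ : Measurable fun x : X₂ × (X₁ × X₁) ↦ (x.2.1, x.1) :=
    measurable_snd.fst.prodMk measurable_fst
  have hπ₀ : Measurable fun x : X₂ × (X₁ × X₁) ↦ (x.1, x.2.2) :=
    measurable_fst.prodMk measurable_snd.snd
  have hπ' : Measurable fun x : X₂ × (X₁ × X₁) ↦ (x.2.2, x.1) :=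
    measurable_snd.snd.prodMk measurable_fst
  -- the `(3, 1)`-marginal of `γ` is `q'`
  have hγq'' : γ.map (fun x ↦ (x.2.2, x.1)) = q' := by
    have e : (fun x : X₂ × (X₁ × X₁) ↦ (x.2.2, x.1)) = Prod.swap ∘ fun x ↦ (x.1, x.2.2) := rfl
    rw [e, ← Measure.map_map measurable_swap hπ₀, hγq',
      Measure.map_map measurable_swap measurable_swap, Prod.swap_swap_eq, Measure.map_id]
  -- integrate the pointwise estimate against `γ`
  calc ∫⁻ p, K p ∂q' = ∫⁻ x, K (x.2.2, x.1) ∂γ := by rw [← hγq'', lintegral_map hK hπ']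
    _ ≤ ∫⁻ x, ((D (x.2.1, x.1) + K (x.2.1, x.1)) + D (x.2.2, x.1)) ∂γ :=
        lintegral_mono fun x ↦
          kernelDistWithin_le_edist_add hH₁ ℭ hs₁ hs₂ ht₁ ht₂ hst x.2.1 x.2.2 x.1
    _ = ∫⁻ x, (D (x.2.1, x.1) + K (x.2.1, x.1)) ∂γ + ∫⁻ x, D (x.2.2, x.1) ∂γ :=
        lintegral_add_left ((hD.fun_add hK).comp hπ) _
    _ = ∫⁻ p, (D p + K p) ∂q + ∫⁻ p, D p ∂q' := by
        congr 1
        · rw [← hγq, lintegral_map (hD.fun_add hK) hπ]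
        · rw [← hγq'', lintegral_map hD hπ']

/-! ### Lemma 5.19: flexibility in the choice of the couplings -/

/-- **Lemma 5.19 for an admissible radius** (Bamler 2023, §5.3, proof of Lemma 5.19 as "a direct
consequence of Lemma 5.18"): if `r` is admissible for `d_𝔽^{ℭ,J}` (Definition (`𝔽`-distance within
correspondence)) and `s ≤ t` lie in `J`, then for any coupling `q'` of `μ¹_t, μ²_t`,
`∫ d_{W₁}^{Z_s}((φ¹_s)_* ν¹_{x¹;s}, (φ²_s)_* ν²_{x²;s}) dq' ≤ ∫ d^Z_t(φ¹_t x¹, φ²_t x²) dq' + 2 r`: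
Lemma 5.18 with `μ₁ = μ'₁ = μ¹_t`, `μ₂ = μ²_t` and `q = q_t` the admissible coupling, whose
integral of `d^Z_t(φ¹_t x¹, φ²_t x²) ≤ d_{W₁}(δ_{φ¹_t x¹}, δ_{φ²_t x²})` (condition (2) at `(t, t)`,
`ν_{x;t} = δ_x`) and of the integrand at `(s, t)` are both `≤ r`.
[cite: Bamler2023, §5.3, Lemma 5.19 (arXiv v1 Lemma 119), proof] -/
theorem lintegral_kernelDistWithin_le_add_two_mul_ofReal {H₁ H₂ : ℝ}
    (hH₁ : P₁.flow.IsHConcentrated H₁) (hH₂ : P₂.flow.IsHConcentrated H₂)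
    (ℭ : Correspondence₂ P₁.flow P₂.flow I'') {J : Set ℝ} (hJ : ℭ.FullyDefinedOver J) {r : ℝ}
    (hr : FDistAdmissible P₁ P₂ ℭ J r) {s t : ℝ} (hs : s ∈ J) (ht : t ∈ J) (hst : s ≤ t)
    {q' : Measure (P₁.flow.Slice ⟨t, (ℭ.dom₁_subset (hJ.1 ht)).1⟩ ×
      P₂.flow.Slice ⟨t, (ℭ.dom₂_subset (hJ.2 ht)).1⟩)}
    (hq' : IsCoupling (P₁.μ ⟨t, (ℭ.dom₁_subset (hJ.1 ht)).1⟩)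
      (P₂.μ ⟨t, (ℭ.dom₂_subset (hJ.2 ht)).1⟩) q') :
    ∫⁻ p, kernelDistWithin P₁ P₂ ℭ (hJ.1 hs) (hJ.2 hs) (hJ.1 ht) (hJ.2 ht) p ∂q' ≤
      ∫⁻ p, edist (ℭ.φ₁ t (hJ.1 ht) p.1) (ℭ.φ₂ t (hJ.2 ht) p.2) ∂q' +
        2 * ENNReal.ofReal r := by
  obtain ⟨_, E, _, _, hJE, hE₁, hE₂, _, q, hq, hint⟩ := hr
  have hsE : s ∈ I'' \ E := hJE hs
  have htE : t ∈ I'' \ E := hJE ht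
  haveI := P₁.isProbabilityMeasure_μ ⟨t, (ℭ.dom₁_subset (hJ.1 ht)).1⟩
  haveI := P₂.isProbabilityMeasure_μ ⟨t, (ℭ.dom₂_subset (hJ.2 ht)).1⟩
  have hm₁ : Measurable (ℭ.φ₁ t (hJ.1 ht)) := (ℭ.isometry₁ t (hJ.1 ht)).continuous.measurable
  have hm₂ : Measurable (ℭ.φ₂ t (hJ.2 ht)) := (ℭ.isometry₂ t (hJ.2 ht)).continuous.measurable
  have hD : Measurable fun p : P₁.flow.Slice ⟨t, (ℭ.dom₁_subset (hJ.1 ht)).1⟩ ×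
      P₂.flow.Slice ⟨t, (ℭ.dom₂_subset (hJ.2 ht)).1⟩ ↦
        edist (ℭ.φ₁ t (hJ.1 ht) p.1) (ℭ.φ₂ t (hJ.2 ht) p.2) :=
    (((ℭ.isometry₁ t (hJ.1 ht)).continuous.comp continuous_fst).edist
      ((ℭ.isometry₂ t (hJ.2 ht)).continuous.comp continuous_snd)).measurable
  -- Lemma 5.18 with `μ₁ = μ'₁ = μ¹_t`, `q = q_t`
  have h518 := lintegral_kernelDistWithin_le_of_isCoupling hH₁ hH₂ ℭ (hJ.1 hs) (hJ.2 hs) (hJ.1 ht)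
    (hJ.2 ht) hst (hq t htE) hq'
  -- condition (2) at `(t, t)`: `∫ d^Z_t(φ¹_t x¹, φ²_t x²) dq_t ≤ r`
  have hDle : ∫⁻ p, edist (ℭ.φ₁ t (hJ.1 ht) p.1) (ℭ.φ₂ t (hJ.2 ht) p.2) ∂(q t htE) ≤
      ENNReal.ofReal r := by
    refine le_trans (lintegral_mono fun p ↦ ?_) (hint t htE t htE le_rfl)
    show edist (ℭ.φ₁ t (hE₁ htE) p.1) (ℭ.φ₂ t (hE₂ htE) p.2) ≤
      kernelDistWithin P₁ P₂ ℭ (hE₁ htE) (hE₂ htE) (hE₁ htE) (hE₂ htE) p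
    unfold kernelDistWithin
    rw [P₁.flow.condKernel_self, P₂.flow.condKernel_self, Measure.map_dirac' hm₁,
      Measure.map_dirac' hm₂]
    exact edist_le_wassersteinW1_dirac _ _
  -- hence `∫ (d^Z_t + d_{W₁}) dq_t ≤ r + r`
  have hDK : ∫⁻ p, (edist (ℭ.φ₁ t (hJ.1 ht) p.1) (ℭ.φ₂ t (hJ.2 ht) p.2) +
      kernelDistWithin P₁ P₂ ℭ (hJ.1 hs) (hJ.2 hs) (hJ.1 ht) (hJ.2 ht) p) ∂(q t htE) ≤
        2 * ENNReal.ofReal r := by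
    rw [lintegral_add_left hD, two_mul]
    exact add_le_add hDle (hint s hsE t htE hst)
  calc _ ≤ _ := h518
    _ ≤ 2 * ENNReal.ofReal r +
          ∫⁻ p, edist (ℭ.φ₁ t (hJ.1 ht) p.1) (ℭ.φ₂ t (hJ.2 ht) p.2) ∂q' := add_le_add hDK le_rfl
    _ = _ := add_comm _ _

/-- **Bamler 2023, Lemma 5.19 (arXiv v1 Lemma 119): flexibility in the choice of the couplings.**
For a correspondence `ℭ` between the flows of two `H`-concentrated metric flow pairs, fully defined
over `J`, times `s ≤ t` in `J` and ANY coupling `q'` of `μ¹_t, μ²_t`: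
`∫ d_{W₁}^{Z_s}((φ¹_s)_* ν¹_{x¹;s}, (φ²_s)_* ν²_{x²;s}) dq'(x¹, x²) ≤
∫ d^Z_t(φ¹_t x¹, φ²_t x²) dq'(x¹, x²) + 2 d_𝔽^{ℭ,J}((𝒳¹, (μ¹_t)), (𝒳², (μ²_t)))` (in `[0, ∞]`; the
source states it for `J = {s, t}`). Proof: `lintegral_kernelDistWithin_le_add_two_mul_ofReal` for
every admissible radius, then the infimum defining `d_𝔽^{ℭ,J}` (`ENNReal.mul_iInf_of_ne`,
`ENNReal.add_iInf`). [cite: Bamler2023, §5.3, Lemma 5.19 (arXiv v1 Lemma 119)] -/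
theorem lintegral_kernelDistWithin_le_add_two_mul_fDistWithin {H₁ H₂ : ℝ}
    (hH₁ : P₁.flow.IsHConcentrated H₁) (hH₂ : P₂.flow.IsHConcentrated H₂)
    (ℭ : Correspondence₂ P₁.flow P₂.flow I'') {J : Set ℝ} (hJ : ℭ.FullyDefinedOver J)
    {s t : ℝ} (hs : s ∈ J) (ht : t ∈ J) (hst : s ≤ t)
    {q' : Measure (P₁.flow.Slice ⟨t, (ℭ.dom₁_subset (hJ.1 ht)).1⟩ ×
      P₂.flow.Slice ⟨t, (ℭ.dom₂_subset (hJ.2 ht)).1⟩)}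
    (hq' : IsCoupling (P₁.μ ⟨t, (ℭ.dom₁_subset (hJ.1 ht)).1⟩)
      (P₂.μ ⟨t, (ℭ.dom₂_subset (hJ.2 ht)).1⟩) q') :
    ∫⁻ p, kernelDistWithin P₁ P₂ ℭ (hJ.1 hs) (hJ.2 hs) (hJ.1 ht) (hJ.2 ht) p ∂q' ≤
      ∫⁻ p, edist (ℭ.φ₁ t (hJ.1 ht) p.1) (ℭ.φ₂ t (hJ.2 ht) p.2) ∂q' +
        2 * fDistWithin P₁ P₂ ℭ J := by
  calc ∫⁻ p, kernelDistWithin P₁ P₂ ℭ (hJ.1 hs) (hJ.2 hs) (hJ.1 ht) (hJ.2 ht) p ∂q'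
      ≤ ⨅ (r : ℝ) (_ : FDistAdmissible P₁ P₂ ℭ J r),
          (∫⁻ p, edist (ℭ.φ₁ t (hJ.1 ht) p.1) (ℭ.φ₂ t (hJ.2 ht) p.2) ∂q' +
            2 * ENNReal.ofReal r) :=
        le_iInf₂ fun _ hr ↦
          lintegral_kernelDistWithin_le_add_two_mul_ofReal hH₁ hH₂ ℭ hJ hr hs ht hst hq'
    _ = _ := by
        simp only [fDistWithin, ENNReal.mul_iInf_of_ne (two_ne_zero' ℝ≥0∞) ENNReal.ofNat_ne_top,
          ENNReal.add_iInf]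

end MetricFlowPair

end Literature.Geometry.Riemannian

end
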